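import Mathlib.Analysis.Complex.TaylorSeries
import Mathlib.Analysis.Complex.Liouville
import Mathlib.Analysis.Analytic.OfScalars
import Mathlib.Analysis.Calculus.IteratedDeriv.Lemmas
import Mathlib.Analysis.SpecialFunctions.ExpDeriv
import Literature.Probability.LatticeModels.CumulantRecursion
import HarnessLib

/-!
# Cumulants as Taylor coefficients of `log` of a generating function; zeros from coefficient bounds

Topic `Literature/Probability/LatticeModels`; the analytic companion of `CumulantRecursion.lean`
(where the cumulants `cumulantOf μ n` of a moment sequence are defined COMBINATORIALLY, by Möbius
inversion over set partitions, and shown to satisfy `μₙ₊₁ = Σₖ C(n,k) κₖ₊₁ μₙ₋ₖ`).  Here: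

* `eq_cumulantOf_of_recursion` — the recursion determines the cumulants (uniqueness);
* `iteratedDeriv_succ_eq_cumulantOf` — if `f = exp ∘ L` near `0` with `f, L` analytic at `0` and
  `f 0 = 1`, then `L^{(n+1)}(0) = κₙ₊₁` for the moments `μₘ = f^{(m)}(0)`: the cumulants ARE the
  Taylor coefficients of any local logarithm of the moment generating function (Camia–Jiang–Newman
  2023, eq. (1) "`u_k := ∂^k log⟨exp Σ h_j σ_j⟩|₀`" ⟺ eq. (2), the partition formula; Jiang–Newman
  2024, (2.2)–(2.4)).  Proof: `f' = L' f` near `0`, Leibniz at `0`, uniqueness.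
* `ne_zero_of_norm_iteratedDeriv_le` — **zeros from coefficient domination**: if `f` is holomorphic
  on `|z| < R` with a local logarithm `Lf` at `0`, `Lg` is holomorphic on `|z| < R`, and
  `‖Lf^{(n)}(0)‖ ≤ ‖Lg^{(n)}(0)‖` for all `n ≥ 1`, then `f` has no zero in `|z| < R` (Cauchy's
  estimates for `Lg` bound the Taylor coefficients of `Lf`, whose Taylor series therefore converges
  on `|z| < R` to an analytic `P` with `exp P = f` near `0`, hence on the disc by the identity
  theorem).  This is the mechanism of the proof of Camia–Jiang–Newman 2023, Thm 2 (the radius of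
  convergence of the cumulant series is the modulus of the first zero, their (12)–(13)).

No definitions; pure Mathlib complex analysis (`Complex.taylorSeries_eq_on_ball'`,
`Complex.norm_iteratedDeriv_le_of_forall_mem_sphere_norm_le`, `FormalMultilinearSeries.ofScalars`,
`AnalyticOnNhd.eqOn_of_preconnected_of_eventuallyEq`, `iteratedDeriv_mul`).

## References

* F. Camia, J. Jiang, C. M. Newman, Comm. Math. Phys. 401 (2023), §1.1 (1)–(2), §1.2 (12)–(13)
  [CamiaJiangNewman2023].
* D. Ruelle, *Statistical Mechanics: Rigorous Results* (1969), §4.4.1 [Ruelle1969].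
-/

noncomputable section

open Finset Filter Metric Complex
open scoped Topology Nat

namespace Literature.Probability.LatticeModels

/-! ### Uniqueness for the moment–cumulant recursion -/

/-- **The moment–cumulant recursion determines the cumulants**: if `μ 0 = 1` and
`μ (m+1) = Σ_{k ≤ m} C(m,k) t_k μ_{m-k}` for all `m`, then `t n = κ_{n+1}`. [folklore] -/
theorem eq_cumulantOf_of_recursion {C : Type*} [CommRing C] (μ : ℕ → C) (hμ : μ 0 = 1)
    (t : ℕ → C)
    (ht : ∀ m, μ (m + 1) = ∑ k ∈ range (m + 1), (m.choose k : C) * t k * μ (m - k)) (n : ℕ) :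
    t n = cumulantOf μ (n + 1) := by
  induction n using Nat.strong_induction_on with
  | _ n ih =>
    have h1 := ht n
    have h2 := moment_succ_eq_sum_choose_mul_cumulantOf μ hμ n
    rw [sum_range_succ, Nat.choose_self, Nat.sub_self, hμ] at h1 h2
    have h3 : ∑ k ∈ range n, (n.choose k : C) * t k * μ (n - k) =
        ∑ k ∈ range n, (n.choose k : C) * cumulantOf μ (k + 1) * μ (n - k) :=
      sum_congr rfl fun k hk => by rw [ih k (mem_range.1 hk)]
    rw [h3] at h1
    have := h1.symm.trans h2
    simpa using this

/-! ### Cumulants are the Taylor coefficients of a local logarithm -/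

/-- If `f = exp ∘ L` near `0` with `L` analytic at `0`, then `f' = L' · f` near `0`. [folklore] -/
theorem eventually_deriv_eq_deriv_mul {f L : ℂ → ℂ} (hL : AnalyticAt ℂ L 0)
    (hfL : ∀ᶠ z in 𝓝 0, f z = exp (L z)) :
    deriv f =ᶠ[𝓝 0] fun z => deriv L z * f z := by
  filter_upwards [hL.eventually_analyticAt, eventually_eventually_nhds.2 hfL] with z hLz hz
  have hfz : f z = exp (L z) := hz.self_of_nhds
  have hd : deriv f z = deriv (fun w => exp (L w)) z := Filter.EventuallyEq.deriv_eq hz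
  rw [hd, hLz.differentiableAt.hasDerivAt.cexp.deriv, hfz, mul_comm]

/-- **Cumulants are the derivatives at `0` of `log` of the moment generating function**
(Camia–Jiang–Newman 2023, (1) ⟺ (2); Jiang–Newman 2024, (2.2)–(2.3)): if `f` and `L` are analytic
at `0`, `f = exp ∘ L` near `0` and `f 0 = 1`, then for the moments `μₘ = f^{(m)}(0)`,
`L^{(n+1)}(0) = κₙ₊₁ = cumulantOf μ (n+1)`. [cite: CamiaJiangNewman2023, §1.1 eqs. (1)-(2)] -/
theorem iteratedDeriv_succ_eq_cumulantOf {f L : ℂ → ℂ} (hf : AnalyticAt ℂ f 0)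
    (hL : AnalyticAt ℂ L 0) (hfL : ∀ᶠ z in 𝓝 0, f z = exp (L z)) (hf0 : f 0 = 1) (n : ℕ) :
    iteratedDeriv (n + 1) L 0 = cumulantOf (fun m => iteratedDeriv m f 0) (n + 1) := by
  have hrec : ∀ m, iteratedDeriv (m + 1) f 0 = ∑ k ∈ range (m + 1),
      (m.choose k : ℂ) * iteratedDeriv (k + 1) L 0 * iteratedDeriv (m - k) f 0 := by
    intro m
    rw [iteratedDeriv_succ', (eventually_deriv_eq_deriv_mul hL hfL).iteratedDeriv_eq m]
    have hmul := iteratedDeriv_mul (n := m) (x := (0 : ℂ)) (f := deriv L) (g := f)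
      (hL.deriv.contDiffAt.of_le le_top) (hf.contDiffAt.of_le le_top)
    have hfun : (deriv L * f) = fun z => deriv L z * f z := rfl
    rw [hfun] at hmul
    rw [hmul]
    refine sum_congr rfl fun k _ => ?_
    rw [iteratedDeriv_succ']
  exact eq_cumulantOf_of_recursion (fun m => iteratedDeriv m f 0) (by simpa using hf0)
    (fun k => iteratedDeriv (k + 1) L 0) hrec n

/-! ### Zeros from domination of the Taylor coefficients of the logarithm -/

/-- **No zeros from coefficient domination.** Let `f` be holomorphic on `|z| < R` with a local
logarithm `Lf` at `0` (`f = exp ∘ Lf` near `0`, `Lf` analytic at `0`), and let `Lg` be holomorphic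
on `|z| < R` with `‖Lf^{(n)}(0)‖ ≤ ‖Lg^{(n)}(0)‖` for all `n ≥ 1`. Then `f ≠ 0` on `|z| < R`:
Cauchy's estimates for `Lg` make the Taylor series of `Lf` converge on `|z| < R`, to an analytic
`P` with `exp ∘ P = f` near `0` and hence on the disc. (The mechanism of Camia–Jiang–Newman 2023,
proof of Thm 2: the cumulant series has radius of convergence the modulus of the first zero.)
[cite: CamiaJiangNewman2023, §1.2 eqs. (12)-(13)] -/
theorem ne_zero_of_norm_iteratedDeriv_le {f Lf Lg : ℂ → ℂ} {R : ℝ}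
    (hf : DifferentiableOn ℂ f (ball 0 R)) (hLf : AnalyticAt ℂ Lf 0)
    (hfLf : ∀ᶠ z in 𝓝 0, f z = exp (Lf z)) (hLg : DifferentiableOn ℂ Lg (ball 0 R))
    (hdom : ∀ n, 1 ≤ n → ‖iteratedDeriv n Lf 0‖ ≤ ‖iteratedDeriv n Lg 0‖) {z₀ : ℂ}
    (hz₀ : z₀ ∈ ball (0 : ℂ) R) : f z₀ ≠ 0 := by
  -- radii `‖z₀‖ < r < ρ < R`
  have hz₀' : ‖z₀‖ < R := by simpa using hz₀
  obtain ⟨r, hzr, hrR⟩ := exists_between hz₀'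
  obtain ⟨ρ, hrρ, hρR⟩ := exists_between hrR
  have hr0 : 0 < r := (norm_nonneg _).trans_lt hzr
  have hρ0 : 0 < ρ := hr0.trans hrρ
  -- Cauchy's estimates for `Lg` on the circle of radius `ρ`
  have hsph : sphere (0 : ℂ) ρ ⊆ ball 0 R := sphere_subset_closedBall.trans (closedBall_subset_ball hρR)
  obtain ⟨M, hM⟩ : ∃ M, ∀ z ∈ sphere (0 : ℂ) ρ, ‖Lg z‖ ≤ M :=
    (isCompact_sphere (0 : ℂ) ρ).exists_bound_of_continuousOn (hLg.continuousOn.mono hsph)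
  have hdc : DiffContOnCl ℂ Lg (ball 0 ρ) := by
    refine DifferentiableOn.diffContOnCl ?_
    rw [closure_ball _ hρ0.ne']
    exact hLg.mono (closedBall_subset_ball hρR)
  have hcauchy : ∀ n, ‖iteratedDeriv n Lg 0‖ ≤ n ! * M / ρ ^ n := fun n =>
    Complex.norm_iteratedDeriv_le_of_forall_mem_sphere_norm_le n hρ0 hdc hM
  have hM0 : 0 ≤ M := by
    have h := hcauchy 0
    simp only [Nat.factorial_zero, Nat.cast_one, one_mul, pow_zero, div_one] at h
    exact (norm_nonneg _).trans h
  -- the Taylor coefficients of `Lf` and the bound `‖aₙ‖ rⁿ ≤ max M ‖a₀‖`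
  set a : ℕ → ℂ := fun n => iteratedDeriv n Lf 0 / n ! with ha
  have hbound : ∀ n, ‖a n‖ * r ^ n ≤ max M ‖a 0‖ := by
    intro n
    rcases Nat.eq_zero_or_pos n with rfl | hn
    · simp
    · have hfac : (0 : ℝ) < n ! := by positivity
      calc ‖a n‖ * r ^ n = ‖iteratedDeriv n Lf 0‖ / n ! * r ^ n := by
            rw [ha]
            dsimp only
            rw [norm_div, Complex.norm_natCast]
        _ ≤ (n ! * M / ρ ^ n) / n ! * r ^ n := by
            gcongr
            exact (hdom n hn).trans (hcauchy n)
        _ = M * (r / ρ) ^ n := by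
            rw [div_pow]
            field_simp
        _ ≤ M * 1 := by
            gcongr
            exact pow_le_one₀ (div_nonneg hr0.le hρ0.le) ((div_le_one hρ0).2 hrρ.le)
        _ ≤ max M ‖a 0‖ := by rw [mul_one]; exact le_max_left _ _
  -- the power series `P = Σ aₙ zⁿ` converges on `|z| < r`
  set r' : NNReal := ⟨r, hr0.le⟩ with hr'
  set p : FormalMultilinearSeries ℂ ℂ ℂ := FormalMultilinearSeries.ofScalars ℂ a with hp
  have hr_le : (r' : ENNReal) ≤ p.radius := by
    refine p.le_radius_of_eventually_le (max M ‖a 0‖) (Eventually.of_forall fun n => ?_)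
    rw [hp, FormalMultilinearSeries.ofScalars_norm]
    exact hbound n
  have hr'0 : (0 : NNReal) < r' := by rw [← NNReal.coe_pos]; exact hr0
  have hrad : 0 < p.radius := lt_of_lt_of_le (ENNReal.coe_pos.2 hr'0) hr_le
  have hps := p.hasFPowerSeriesOnBall hrad
  set P : ℂ → ℂ := p.sum with hP
  have hball : ∀ z : ℂ, z ∈ ball (0 : ℂ) r → z ∈ Metric.eball (0 : ℂ) p.radius := by
    intro z hz
    refine Metric.eball_subset_eball hr_le ?_
    rw [Metric.eball_coe]
    exact hz
  have hPan : AnalyticOnNhd ℂ P (ball 0 r) := fun z hz => hps.analyticAt_of_mem (hball z hz)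
  have hPz : ∀ z, P z = ∑' n : ℕ, a n • z ^ n := fun z => by
    rw [hP, hp]
    exact FormalMultilinearSeries.ofScalars_sum_eq a z
  -- `P = Lf` near `0`
  obtain ⟨ε, hε0, hε⟩ : ∃ ε > 0, ∀ w ∈ ball (0 : ℂ) ε, AnalyticAt ℂ Lf w := by
    obtain ⟨ε, hε0, h⟩ := Metric.eventually_nhds_iff_ball.1 hLf.eventually_analyticAt
    exact ⟨ε, hε0, h⟩
  have hLfd : DifferentiableOn ℂ Lf (ball 0 ε) := fun w hw => (hε w hw).differentiableAt.differentiableWithinAt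
  have hPLf : ∀ z ∈ ball (0 : ℂ) ε, P z = Lf z := by
    intro z hz
    have hT := Complex.taylorSeries_eq_on_ball' hz hLfd
    rw [hPz, ← hT]
    refine tsum_congr fun n => ?_
    rw [sub_zero, smul_eq_mul, ha]
    dsimp only
    ring
  -- `exp ∘ P = f` near `0`, hence on `|z| < r`
  have hfan : AnalyticOnNhd ℂ f (ball 0 r) :=
    (hf.mono (ball_subset_ball hrR.le)).analyticOnNhd isOpen_ball
  have hexpP : AnalyticOnNhd ℂ (fun z => exp (P z)) (ball 0 r) := fun z hz => (hPan z hz).cexp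
  have hev0 : (fun z => exp (P z)) =ᶠ[𝓝 (0 : ℂ)] f := by
    filter_upwards [isOpen_ball.mem_nhds (mem_ball_self hε0), hfLf] with z hz hfz
    rw [hPLf z hz, hfz]
  have heq := hexpP.eqOn_of_preconnected_of_eventuallyEq hfan
    (convex_ball (0 : ℂ) r).isPreconnected (mem_ball_self hr0) hev0
  have hz₀r : z₀ ∈ ball (0 : ℂ) r := by simpa using hzr
  rw [← heq hz₀r]
  exact exp_ne_zero _

end Literature.Probability.LatticeModels
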